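import Literature.NumberTheory.Transcendental.KZLogCalculusProofs
import Literature.NumberTheory.Transcendental.KZRulesAssociator
import Literature.NumberTheory.Transcendental.SemialgebraicLineDeriv
import Literature.NumberTheory.Transcendental.BoxIntegralHurwitzWeightTwo
import Literature.NumberTheory.Transcendental.GammaMonomialsProofs
import Summits.KontsevichZagierPeriods.KontsevichZagierPeriods.Theorems.HurwitzMicroSectorsHurwitzSectorComplementStubSymReductionKit
import Summits.KontsevichZagierPeriods.KontsevichZagierPeriods.Theorems.ReducedPeriodRing.Negative.Certificates

/-!
# `HurwitzSectorComplement` (stmt-KontsevichZagierPeriods-14341), line `chebyshev-level-deformation`,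
# stub S3 `stub_ladderDescent` — part 1: the `ℚ·𝔭`-bookkeeping

The normal form of the Chebyshev ladder is `𝔭_d = [(0,1)^d, ∏ 2/(1+x_i²)]` (value `(π/2)^d`), and
"`r ∈ ℚ·𝔭_d`" is always spelled

  `∃ q : ℚ, ∀ s : KZ.IntegralRep d, s.domain = (0,1)^d → s.integrand = q ∏ 2/(1+x_i²) on it → r ∼ s`.

This def-free file provides the closure properties of that predicate used by the descent:
existence of the pinned comparison representations (`exists_pinned`), invariance under
equivalence, under the relation shapes `[r] − [r₁] + [r₂] ∈ rel` (one integrand-additivity move)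
and `N•[r] − M•[r'] ∈ rel`, `N ≠ 0` (torsion-freeness of `FormalRep ⧸ relations`, read in the formal
period ring `KZ.FormalPeriodRing` where every `N ≥ 1` is a unit), and under Fubini products
(`KZ.Equivalent.prod`, `𝔭_a × 𝔭_b` is pinned-equal to `𝔭_{a+b}`); plus the two elementary facts on
the cyclotomic half-angles `v₀ = tan(πj/L)` (`0 < j`, `2j < L`): `0 < v₀`, `v₀` algebraic; and the
`ℕ`-linearity of a level-`L` sector family `σ` of the landed kit `SymReduction.symReduction_kit`.

References: M. Kontsevich, D. Zagier, *Periods* (2001), §1.2.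
-/

noncomputable section

open Set MeasureTheory Polynomial
open scoped BigOperators
open Literature.NumberTheory.Transcendental
open Literature.ModelTheory.ExponentialFields (IsSemialgebraic)

namespace Summit.KontsevichZagierPeriods.Theorems.HurwitzMicroSectorsHurwitzSectorComplement.LadderDescent

/-! ## The weight `∏ 2/(1+y_i²)` -/

/-- `|∏_{i<k} 2/(1+y_i²)| ≤ 2^k`. [folklore] -/
theorem abs_prod_omega_le {k : ℕ} (y : Fin k → ℝ) : |∏ i, 2 / (1 + (y i) ^ 2)| ≤ 2 ^ k := by
  rw [Finset.abs_prod]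
  calc ∏ i, |2 / (1 + (y i) ^ 2)| ≤ ∏ _i : Fin k, (2 : ℝ) :=
        Finset.prod_le_prod (fun i _ => abs_nonneg _) fun i _ => by
          rw [abs_of_pos (by positivity), div_le_iff₀ (by positivity)]
          nlinarith [sq_nonneg (y i)]
    _ = 2 ^ k := by simp

/-- The weight `y ↦ ∏ 2/(1+y_i²)` is `ℚ`-semialgebraic on every `ℚ`-semialgebraic set. [folklore] -/
theorem isSemialgebraicFunOn_prodOmega {k : ℕ} {S : Set (Fin k → ℝ)} (hS : IsSemialgebraic ℚ S) :
    IsSemialgebraicFunOn ℚ S (fun y => ∏ i, 2 / (1 + (y i) ^ 2)) :=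
  IsSemialgebraicFunOn.fun_finsetProd Finset.univ hS fun i _ =>
    (isSemialgebraicFunOn_const_ofNat hS 2).div
      ((isSemialgebraicFunOn_aeval hS (1 + MvPolynomial.X i ^ 2 : MvPolynomial (Fin k) ℚ)).congr
        fun y _ => by simp)
      fun y _ => by positivity

/-! ## Pinned comparison representations `[(0,1)^d, q ∏ 2/(1+x_i²)]` -/

/-- **Existence of the pinned comparison representations**: for every `d` and `q ∈ ℚ` there is a
representation with domain `(0,1)^d` and integrand literally `q ∏ 2/(1+x_i²)` (bounded by `|q| 2^d`
on a set of measure `1`). [cite: KontsevichZagier2001, §1.1] -/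
theorem exists_pinned (d : ℕ) (q : ℚ) : ∃ s : KZ.IntegralRep d,
    s.domain = {x | ∀ i, x i ∈ Set.Ioo (0:ℝ) 1} ∧
    s.integrand = fun x => (q : ℝ) * ∏ i, 2 / (1 + (x i) ^ 2) := by
  have hB := SymReduction.isSemialgebraic_unitBox d
  have hsa : IsSemialgebraicFunOn ℚ {x : Fin d → ℝ | ∀ i, x i ∈ Set.Ioo (0:ℝ) 1}
      (fun x => (q : ℝ) * ∏ i, 2 / (1 + (x i) ^ 2)) :=
    (isSemialgebraicFunOn_const_ratCast hB q).fun_mul (isSemialgebraicFunOn_prodOmega hB)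
  refine ⟨⟨_, _, hB, hsa, ?_⟩, rfl, rfl⟩
  refine Integrable.mono' (g := fun _ => |(q : ℝ)| * 2 ^ d)
    (integrableOn_const (by rw [BoxIntegral.volume_box]; exact ENNReal.one_ne_top))
    (KZ.aestronglyMeasurable_of_isSemialgebraicFunOn hsa (BoxIntegral.measurableSet_box d))
    (Filter.Eventually.of_forall fun x => ?_)
  rw [Real.norm_eq_abs, abs_mul]
  exact mul_le_mul_of_nonneg_left (abs_prod_omega_le x) (abs_nonneg _)

/-- Two representations pinned to the same `[(0,1)^d, q ∏ 2/(1+x_i²)]` are equivalent (congruence).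
[cite: KontsevichZagier2001, §1.2 rule (1)] -/
theorem pinned_equivalent {d : ℕ} (q : ℚ) (s s' : KZ.IntegralRep d)
    (hsd : s.domain = {x | ∀ i, x i ∈ Set.Ioo (0:ℝ) 1})
    (hsi : EqOn s.integrand (fun x => (q : ℝ) * ∏ i, 2 / (1 + (x i) ^ 2)) s.domain)
    (hs'd : s'.domain = {x | ∀ i, x i ∈ Set.Ioo (0:ℝ) 1})
    (hs'i : EqOn s'.integrand (fun x => (q : ℝ) * ∏ i, 2 / (1 + (x i) ^ 2)) s'.domain) :
    KZ.Equivalent s s' :=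
  KZ.of_sub_of_mem_relations_of_eqOn (hs'd.trans hsd.symm) fun x hx => by
    rw [hsi hx, hs'i (by rwa [hs'd, ← hsd])]

/-- Integrand additivity of pinned representations: `[q₁+q₂] − [q₁] − [q₂]` is a relation.
[cite: KontsevichZagier2001, §1.2 rule (1)] -/
theorem pinned_add {d : ℕ} (q₁ q₂ : ℚ) (s₁ s₂ s : KZ.IntegralRep d)
    (h₁d : s₁.domain = {x | ∀ i, x i ∈ Set.Ioo (0:ℝ) 1})
    (h₁i : EqOn s₁.integrand (fun x => (q₁ : ℝ) * ∏ i, 2 / (1 + (x i) ^ 2)) s₁.domain)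
    (h₂d : s₂.domain = {x | ∀ i, x i ∈ Set.Ioo (0:ℝ) 1})
    (h₂i : EqOn s₂.integrand (fun x => (q₂ : ℝ) * ∏ i, 2 / (1 + (x i) ^ 2)) s₂.domain)
    (hd : s.domain = {x | ∀ i, x i ∈ Set.Ioo (0:ℝ) 1})
    (hi : EqOn s.integrand (fun x => ((q₁ + q₂ : ℚ) : ℝ) * ∏ i, 2 / (1 + (x i) ^ 2)) s.domain) :
    KZ.of s - KZ.of s₁ - KZ.of s₂ ∈ KZ.relations :=
  KZ.integrandAddRel_subset_relations ⟨d, s, s₁, s₂, h₁d.trans hd.symm, h₂d.trans hd.symm,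
    fun x hx => by
      rw [Pi.add_apply, hi hx, h₁i (by rwa [h₁d, ← hd]), h₂i (by rwa [h₂d, ← hd])]
      push_cast
      ring, rfl⟩

/-- `ℕ`-multiples of pinned representations: `N • [q] − [N q]` is a relation
(`KZ.IntegralRep.of_constMul_nat_sub_nsmul_mem_relations` + congruence).
[cite: KontsevichZagier2001, §1.2 rule (1)] -/
theorem pinned_nsmul {d : ℕ} (N : ℕ) (q : ℚ) (s s' : KZ.IntegralRep d)
    (hsd : s.domain = {x | ∀ i, x i ∈ Set.Ioo (0:ℝ) 1})
    (hsi : EqOn s.integrand (fun x => (q : ℝ) * ∏ i, 2 / (1 + (x i) ^ 2)) s.domain)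
    (hs'd : s'.domain = {x | ∀ i, x i ∈ Set.Ioo (0:ℝ) 1})
    (hs'i : EqOn s'.integrand (fun x => ((N * q : ℚ) : ℝ) * ∏ i, 2 / (1 + (x i) ^ 2)) s'.domain) :
    N • KZ.of s - KZ.of s' ∈ KZ.relations := by
  have h1 := KZ.IntegralRep.of_constMul_nat_sub_nsmul_mem_relations s N
  have h2 : KZ.of (s.constMul (N : ℝ) (isAlgebraic_nat N)) - KZ.of s' ∈ KZ.relations :=
    KZ.of_sub_of_mem_relations_of_eqOn (by rw [KZ.IntegralRep.domain_constMul, hsd, hs'd])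
      fun x hx => by
        rw [KZ.IntegralRep.domain_constMul] at hx
        rw [KZ.IntegralRep.integrand_constMul]
        dsimp only
        rw [hsi hx, hs'i (by rwa [hs'd, ← hsd])]
        push_cast
        ring
  convert KZ.relations.sub_mem h2 h1 using 1
  abel

/-- **Torsion-freeness of `FormalRep ⧸ relations`**, read in the formal period ring where `N ≥ 1`
is a unit (`isUnit_natCast_formalPeriodRing`). [cite: KontsevichZagier2001, §1.2] -/
theorem mem_relations_of_nsmul_mem {N : ℕ} (hN : N ≠ 0) {c : KZ.FormalRep}
    (h : N • c ∈ KZ.relations) : c ∈ KZ.relations := by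
  rw [← KZ.toFormalPeriod_eq_zero_iff] at h ⊢
  rw [map_nsmul, nsmul_eq_mul] at h
  exact (Summit.KontsevichZagierPeriods.KontsevichZagierPeriods.ReducedPeriodRingNegative.isUnit_natCast_formalPeriodRing
    (Nat.pos_of_ne_zero hN)).mul_right_eq_zero.mp h

/-! ## Closure properties of `r ∈ ℚ·𝔭_d` -/

/-- Introduction: a representation equivalent to ONE pinned `[(0,1)^d, q ∏ 2/(1+x_i²)]` lies in
`ℚ·𝔭_d`. [cite: KontsevichZagier2001, §1.2] -/
theorem inQP_intro {n d : ℕ} (r : KZ.IntegralRep n) (q : ℚ) (s : KZ.IntegralRep d)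
    (hsd : s.domain = {x | ∀ i, x i ∈ Set.Ioo (0:ℝ) 1})
    (hsi : EqOn s.integrand (fun x => (q : ℝ) * ∏ i, 2 / (1 + (x i) ^ 2)) s.domain)
    (h : KZ.Equivalent r s) :
    ∃ q : ℚ, ∀ (s : KZ.IntegralRep d), s.domain = {x | ∀ i, x i ∈ Set.Ioo (0:ℝ) 1} →
      Set.EqOn s.integrand (fun x => (q : ℝ) * ∏ i, 2 / (1 + (x i) ^ 2)) s.domain →
      KZ.Equivalent r s :=
  ⟨q, fun s' hs'd hs'i => h.trans (pinned_equivalent q s s' hsd hsi hs'd hs'i)⟩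

/-- `ℚ·𝔭_d` is invariant under equivalence. [cite: KontsevichZagier2001, §1.2] -/
theorem inQP_of_equivalent {n n' d : ℕ} {r : KZ.IntegralRep n} {r' : KZ.IntegralRep n'}
    (hrr' : KZ.Equivalent r r')
    (h : ∃ q : ℚ, ∀ (s : KZ.IntegralRep d), s.domain = {x | ∀ i, x i ∈ Set.Ioo (0:ℝ) 1} →
      Set.EqOn s.integrand (fun x => (q : ℝ) * ∏ i, 2 / (1 + (x i) ^ 2)) s.domain →
      KZ.Equivalent r' s) :
    ∃ q : ℚ, ∀ (s : KZ.IntegralRep d), s.domain = {x | ∀ i, x i ∈ Set.Ioo (0:ℝ) 1} →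
      Set.EqOn s.integrand (fun x => (q : ℝ) * ∏ i, 2 / (1 + (x i) ^ 2)) s.domain →
      KZ.Equivalent r s := by
  obtain ⟨q, h⟩ := h
  exact ⟨q, fun s hsd hsi => hrr'.trans (h s hsd hsi)⟩

/-- `ℚ·𝔭_d` along a propositional equality of dimensions. [folklore] -/
theorem inQP_cast {n a b : ℕ} {r : KZ.IntegralRep n} (hab : a = b)
    (h : ∃ q : ℚ, ∀ (s : KZ.IntegralRep a), s.domain = {x | ∀ i, x i ∈ Set.Ioo (0:ℝ) 1} →
      Set.EqOn s.integrand (fun x => (q : ℝ) * ∏ i, 2 / (1 + (x i) ^ 2)) s.domain →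
      KZ.Equivalent r s) :
    ∃ q : ℚ, ∀ (s : KZ.IntegralRep b), s.domain = {x | ∀ i, x i ∈ Set.Ioo (0:ℝ) 1} →
      Set.EqOn s.integrand (fun x => (q : ℝ) * ∏ i, 2 / (1 + (x i) ^ 2)) s.domain →
      KZ.Equivalent r s := by
  subst hab
  exact h

/-- **Closure under the T-step shape**: `[r] − [r₁] + [r₂] ∈ rel`, `r₁, r₂ ∈ ℚ·𝔭_d` ⟹ `r ∈ ℚ·𝔭_d`
(`q = q₁ − q₂`, one integrand-additivity move). [cite: KontsevichZagier2001, §1.2 rule (1)] -/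
theorem inQP_of_rel {n n₁ n₂ d : ℕ} {r : KZ.IntegralRep n} {r₁ : KZ.IntegralRep n₁}
    {r₂ : KZ.IntegralRep n₂} (hrel : KZ.of r - KZ.of r₁ + KZ.of r₂ ∈ KZ.relations)
    (h₁ : ∃ q : ℚ, ∀ (s : KZ.IntegralRep d), s.domain = {x | ∀ i, x i ∈ Set.Ioo (0:ℝ) 1} →
      Set.EqOn s.integrand (fun x => (q : ℝ) * ∏ i, 2 / (1 + (x i) ^ 2)) s.domain →
      KZ.Equivalent r₁ s)
    (h₂ : ∃ q : ℚ, ∀ (s : KZ.IntegralRep d), s.domain = {x | ∀ i, x i ∈ Set.Ioo (0:ℝ) 1} →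
      Set.EqOn s.integrand (fun x => (q : ℝ) * ∏ i, 2 / (1 + (x i) ^ 2)) s.domain →
      KZ.Equivalent r₂ s) :
    ∃ q : ℚ, ∀ (s : KZ.IntegralRep d), s.domain = {x | ∀ i, x i ∈ Set.Ioo (0:ℝ) 1} →
      Set.EqOn s.integrand (fun x => (q : ℝ) * ∏ i, 2 / (1 + (x i) ^ 2)) s.domain →
      KZ.Equivalent r s := by
  obtain ⟨q₁, h₁⟩ := h₁
  obtain ⟨q₂, h₂⟩ := h₂
  obtain ⟨s₁, hs₁d, hs₁i⟩ := exists_pinned d q₁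
  obtain ⟨s₂, hs₂d, hs₂i⟩ := exists_pinned d q₂
  refine ⟨q₁ - q₂, fun s hsd hsi => ?_⟩
  have hadd : KZ.of s₁ - KZ.of s - KZ.of s₂ ∈ KZ.relations :=
    pinned_add (q₁ - q₂) q₂ s s₂ s₁ hsd hsi hs₂d (fun x _ => congrFun hs₂i x) hs₁d
      fun x _ => by rw [sub_add_cancel]; exact congrFun hs₁i x
  have e₁ := h₁ s₁ hs₁d fun x _ => congrFun hs₁i x
  have e₂ := h₂ s₂ hs₂d fun x _ => congrFun hs₂i x
  unfold KZ.Equivalent at e₁ e₂ ⊢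
  convert KZ.relations.add_mem (KZ.relations.sub_mem (KZ.relations.add_mem hrel e₁) e₂) hadd
    using 1
  abel

/-- **Division by a positive integer**: `N•[r] − M•[r'] ∈ rel` with `N ≠ 0` and `r' ∈ ℚ·𝔭_d` ⟹
`r ∈ ℚ·𝔭_d` (`q = M q'/N`; torsion-freeness). [cite: KontsevichZagier2001, §1.2 rule (1)] -/
theorem inQP_of_nsmul {n n' d : ℕ} {r : KZ.IntegralRep n} {r' : KZ.IntegralRep n'} {N M : ℕ}
    (hN : N ≠ 0) (hrel : N • KZ.of r - M • KZ.of r' ∈ KZ.relations)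
    (h' : ∃ q : ℚ, ∀ (s : KZ.IntegralRep d), s.domain = {x | ∀ i, x i ∈ Set.Ioo (0:ℝ) 1} →
      Set.EqOn s.integrand (fun x => (q : ℝ) * ∏ i, 2 / (1 + (x i) ^ 2)) s.domain →
      KZ.Equivalent r' s) :
    ∃ q : ℚ, ∀ (s : KZ.IntegralRep d), s.domain = {x | ∀ i, x i ∈ Set.Ioo (0:ℝ) 1} →
      Set.EqOn s.integrand (fun x => (q : ℝ) * ∏ i, 2 / (1 + (x i) ^ 2)) s.domain →
      KZ.Equivalent r s := by
  obtain ⟨q', h'⟩ := h'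
  obtain ⟨s', hs'd, hs'i⟩ := exists_pinned d q'
  obtain ⟨sM, hsMd, hsMi⟩ := exists_pinned d (M * q')
  refine ⟨M * q' / N, fun s hsd hsi => ?_⟩
  have e : (N : ℚ) * (M * q' / N) = M * q' := by
    field_simp
  have h1 : N • KZ.of s - KZ.of sM ∈ KZ.relations :=
    pinned_nsmul N (M * q' / N) s sM hsd hsi hsMd fun x _ => by rw [e]; exact congrFun hsMi x
  have h2 : M • KZ.of s' - KZ.of sM ∈ KZ.relations :=
    pinned_nsmul M q' s' sM hs'd (fun x _ => congrFun hs'i x) hsMd fun x _ => congrFun hsMi x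
  have h3 := h' s' hs'd fun x _ => congrFun hs'i x
  unfold KZ.Equivalent at h3 ⊢
  refine mem_relations_of_nsmul_mem hN ?_
  convert KZ.relations.sub_mem (KZ.relations.add_mem
    (KZ.relations.add_mem hrel (KZ.relations.nsmul_mem h3 M)) h2) h1 using 1
  simp only [smul_sub]
  abel

/-- **Products**: `r ∈ ℚ·𝔭_a`, `s ∈ ℚ·𝔭_b` ⟹ `r × s ∈ ℚ·𝔭_{a+b}` (`KZ.Equivalent.prod`; the Fubini
product of the pinned representations is pinned to `q₁q₂ ∏ 2/(1+x_i²)` on `(0,1)^{a+b}` by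
`Fin.prod_univ_add`). [cite: KontsevichZagier2001, §4.1] -/
theorem inQP_prod {n m a b : ℕ} {r : KZ.IntegralRep n} {s : KZ.IntegralRep m}
    (hr : ∃ q : ℚ, ∀ (s : KZ.IntegralRep a), s.domain = {x | ∀ i, x i ∈ Set.Ioo (0:ℝ) 1} →
      Set.EqOn s.integrand (fun x => (q : ℝ) * ∏ i, 2 / (1 + (x i) ^ 2)) s.domain →
      KZ.Equivalent r s)
    (hs : ∃ q : ℚ, ∀ (s' : KZ.IntegralRep b), s'.domain = {x | ∀ i, x i ∈ Set.Ioo (0:ℝ) 1} →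
      Set.EqOn s'.integrand (fun x => (q : ℝ) * ∏ i, 2 / (1 + (x i) ^ 2)) s'.domain →
      KZ.Equivalent s s') :
    ∃ q : ℚ, ∀ (s' : KZ.IntegralRep (a + b)), s'.domain = {x | ∀ i, x i ∈ Set.Ioo (0:ℝ) 1} →
      Set.EqOn s'.integrand (fun x => (q : ℝ) * ∏ i, 2 / (1 + (x i) ^ 2)) s'.domain →
      KZ.Equivalent (r.prod s) s' := by
  obtain ⟨q₁, h₁⟩ := hr
  obtain ⟨q₂, h₂⟩ := hs
  obtain ⟨S₁, hS₁d, hS₁i⟩ := exists_pinned a q₁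
  obtain ⟨S₂, hS₂d, hS₂i⟩ := exists_pinned b q₂
  have hE : KZ.Equivalent (r.prod s) (S₁.prod S₂) :=
    KZ.Equivalent.prod (h₁ S₁ hS₁d fun x _ => congrFun hS₁i x)
      (h₂ S₂ hS₂d fun x _ => congrFun hS₂i x)
  refine inQP_intro _ (q₁ * q₂) (S₁.prod S₂) ?_ ?_ hE
  · rw [KZ.IntegralRep.prod_domain]
    ext z
    simp only [KZ.IntegralRep.mem_prodDomain, hS₁d, hS₂d, mem_setOf_eq]
    exact (Fin.forall_fin_add (fun i => z i ∈ Set.Ioo (0:ℝ) 1)).symm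
  · intro z _
    rw [KZ.IntegralRep.prod_integrand_eq, KZ.IntegralRep.prodFun_apply, hS₁i, hS₂i]
    simp only
    rw [Fin.prod_univ_add (fun i => 2 / (1 + (z i) ^ 2))]
    push_cast
    ring

/-! ## The cyclotomic half-angles `tan(πj/L)` -/

/-- For `0 < j`, `2j < L`: `0 < tan(πj/L)` and `tan(πj/L) = sin/cos` is algebraic. [folklore] -/
theorem tan_pos_and_isAlgebraic {j L : ℕ} (hj : 0 < j) (hjL : 2 * j < L) :
    0 < Real.tan (Real.pi * j / L) ∧ IsAlgebraic ℚ (Real.tan (Real.pi * j / L)) := by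
  have hL : 0 < L := by omega
  have hL' : (0 : ℝ) < L := by exact_mod_cast hL
  refine ⟨Real.tan_pos_of_pos_of_lt_pi_div_two (by positivity) ?_, ?_⟩
  · rw [div_lt_div_iff₀ hL' two_pos, mul_assoc]
    refine mul_lt_mul_of_pos_left ?_ Real.pi_pos
    exact_mod_cast (by omega : j * 2 < L)
  · rw [Real.tan_eq_sin_div_cos, div_eq_mul_inv]
    exact (KoblitzOgus.isAlgebraic_sin_rat_mul_pi j hL).mul
      (KoblitzOgus.isAlgebraic_cos_rat_mul_pi j hL).inv

/-- `tan(π·1/4) = 1`: the ladder at `v₀ = 1` is the cyclotomic case `j = 1`, `L = 4`. [folklore] -/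
theorem tan_pi_one_four : Real.tan (Real.pi * (1 : ℕ) / (4 : ℕ)) = 1 := by
  rw [Nat.cast_one, mul_one, Nat.cast_ofNat, Real.tan_pi_div_four]

/-! ## `ℕ`-linearity of a sector family -/

section Family

variable {w L : ℕ} {σ : ℚ[X] → KZ.IntegralRep w}
variable (H : (∀ P, (σ P).domain = {x | ∀ i, x i ∈ Set.Ioo (0 : ℝ) 1}) ∧
  ∀ (P : ℚ[X]) (x : Fin w → ℝ),
    (σ P).integrand x = Polynomial.aeval (∏ i, x i) P / (1 - (∏ i, x i) ^ L))
include H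

/-- Integrand additivity of a sector family as a relation: `[σ(P₁+P₂)] − [σP₁] − [σP₂] ∈ rel`.
[cite: KontsevichZagier2001, §1.2 rule (1)] -/
theorem sigma_add_mem (P₁ P₂ : ℚ[X]) :
    KZ.of (σ (P₁ + P₂)) - KZ.of (σ P₁) - KZ.of (σ P₂) ∈ KZ.relations :=
  KZ.integrandAddRel_subset_relations ⟨w, σ (P₁ + P₂), σ P₁, σ P₂,
    (H.1 P₁).trans (H.1 _).symm, (H.1 P₂).trans (H.1 _).symm, fun x _ => by
      rw [Pi.add_apply, H.2, H.2, H.2, map_add, add_div], rfl⟩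

/-- `ℕ`-multiples inside the numerator: `N • [σ P] − [σ (N P)] ∈ rel`.
[cite: KontsevichZagier2001, §1.2 rule (1)] -/
theorem sigma_nsmul_mem (N : ℕ) (P : ℚ[X]) :
    N • KZ.of (σ P) - KZ.of (σ (C (N : ℚ) * P)) ∈ KZ.relations := by
  induction N with
  | zero =>
    have h0 : KZ.of (σ (C ((0 : ℕ) : ℚ) * P)) ∈ KZ.relations :=
      KZ.of_mem_relations_of_eqOn_zero _ fun x _ => by
        rw [H.2]
        simp
    simpa using KZ.relations.neg_mem h0
  | succ N ih =>
    have hadd := sigma_add_mem H (C (N : ℚ) * P) P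
    have e : C ((N : ℚ)) * P + P = C (((N + 1 : ℕ) : ℚ)) * P := by
      rw [Nat.cast_succ, map_add, map_one, add_mul, one_mul]
    rw [e] at hadd
    convert KZ.relations.sub_mem ih hadd using 1
    rw [succ_nsmul]
    abel

end Family


/-! ## Registered sub-goal -/

/-- **Registered sub-goal `ladderDescent_bookkeeping`** (line `chebyshev-level-deformation`, stub S3):
`ℚ·𝔭` is closed under Fubini products — `r ∈ ℚ·𝔭_a`, `s ∈ ℚ·𝔭_b` ⟹ `r × s ∈ ℚ·𝔭_{a+b}`.
[cite: KontsevichZagier2001, §4.1] -/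
theorem ladderDescent_bookkeeping : ∀ (n m a b : ℕ) (r : KZ.IntegralRep n) (s : KZ.IntegralRep m), (∃ q : ℚ, ∀ (t : KZ.IntegralRep a), t.domain = {x | ∀ i, x i ∈ Set.Ioo (0:ℝ) 1} → Set.EqOn t.integrand (fun x => (q : ℝ) * ∏ i, 2 / (1 + (x i) ^ 2)) t.domain → KZ.Equivalent r t) → (∃ q : ℚ, ∀ (t : KZ.IntegralRep b), t.domain = {x | ∀ i, x i ∈ Set.Ioo (0:ℝ) 1} → Set.EqOn t.integrand (fun x => (q : ℝ) * ∏ i, 2 / (1 + (x i) ^ 2)) t.domain → KZ.Equivalent s t) → ∃ q : ℚ, ∀ (t : KZ.IntegralRep (a + b)), t.domain = {x | ∀ i, x i ∈ Set.Ioo (0:ℝ) 1} → Set.EqOn t.integrand (fun x => (q : ℝ) * ∏ i, 2 / (1 + (x i) ^ 2)) t.domain → KZ.Equivalent (r.prod s) t :=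
  fun _ _ _ _ _ _ hr hs => inQP_prod hr hs

end Summit.KontsevichZagierPeriods.Theorems.HurwitzMicroSectorsHurwitzSectorComplement.LadderDescent

end
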